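import Summits.QuantumFields.BalabanUV.Beta.GAN24.BackgroundExpansionTaylor
import Summits.QuantumFields.BalabanUV.Beta.GAN24.PerturbedEffectiveFormVolumeLimit
import Summits.QuantumFields.BalabanUV.Beta.GAN24.InsertionChainLawCoupling

/-!
# `BalabanUV.Beta.GAN24.PerturbedInsertionChainDecay` — binder row G-an2-4 ∕ (CONV-C), route R7 «TWO CURRENCIES», PART 162 (decay half): THE INSERTION CHAINS AT A COUPLING `u₀ ≠ 0`.
# `X^{(n)}_k(u) = L^{dk}Q_k((𝒢(u)P)^n𝒢(u))Q_kᴴ`, `𝒢(u) = (Δ_a + uP(V))⁻¹` (the letters of the Taylor expansion of the effective form with background at the base point `u`, PART 161),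
# have (UD)+(SR) VOLUME-FREE on PART 129's coupling disc and EL₂ MODULO ONLY the background's pointwise limit — the `u ≠ 0` twin of PART 156 §2 ∕ PART 159.  §1 the conjugated
# letters at coupling `u` (`‖c(P)c(𝒢(u))‖ ≤ κ_cν`, `‖c((𝒢(u)P)^n𝒢(u))‖ ≤ γ_w⁻¹ν(κ_cν)^n`, `ν = (1 − ‖u‖κ_c)⁻¹` — NE2's conjugated Neumann bound + PART 124's chain letter); §2 the
# fine propagator AT COUPLING `u` decays in the block ∕ window currencies volume-free (PART 145's argument through `pairing_le_of_opNorm_conjMat`); §3 (UD)+(SR) of `X^{(n)}(u)` (PART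
# 120's `towerLimitRate_insertion_at_coupling` on Bałaban's tower + PART 126's dictionary, `u`-uniform constants on `‖u‖ ≤ T`); the EL₂ half and the INPUT triple are PART 162's
# second file `PerturbedInsertionChainVolumeLimit` (unit b2b-balaban-gan24-p3, gen 56; v1)

NOT IN PRINT; OUR PROOF ([folklore] bookkeeping BY NAME over NE2's `opNorm_conjMat_pertInv_le_of_wCoercive` ∕ `isUnit_det_conjMat_of_wCoercive` ∕ `conjMat_inv ∕ _add ∕ _smul`,
PART 120 (`opNorm_P_mul_perturbed_le`, `towerLimitRate_insertion_at_coupling`), PART 124 (`opNorm_conjMat_insertion_le`, `hPc_firstOrder`), PART 126 (`hdecB_of_conjBound`,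
`conjMat_sub_const`, `rho_le_one_of_near`, `distK_sub_three_le_rho_of_near`), PART 145 (`single_pairing`, `nsq_single`, `wCoercive_sub_const`, `l1_windowMap_le_block`), PART 144
(`tendsto_mul_pair'`), PART 146 (`norm_mul_apply_le_of_window`), PART 151 (`norm_Pmodel_mul_apply_le`, `tendsto_Pmodel_mul_pair`, `tendsto_pertInv_pair`, `tendsto_avgTow_pair_of_fine`),
PART 159 (`tendsto_one_pair`), `decayRate_of_towerLimitRate`; [Balaban1987RG1] (1.21)–(1.22) p. 264 LOCATE the shapes; nothing printed is a hypothesis).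
HONEST FRAMING (cell contract, verbatim): «discharging `BetaPertH` makes Bałaban's UV stability UNCONDITIONAL — a real constructive-QFT result; it is NOT the
continuum limit and NOT the Clay problem.»  HONEST DEPENDENCY (verbatim): «continuum YM on T⁴ ⇐ BetaPertH ∧ nine spine estimates (0/9 proved); BetaPertH ⇐
(D1) ∧ (D4) ∧ CAP+tail; G-an2-4 gates asym, D1 and NE2/3/4.»

WHAT THIS FILE PROVES (0 sorry, 0 `def`; `R_k(u) = (Δ_a^{(k)} + uP(V)^{(k)})⁻¹`, `X^{(n)}_k(u) = avgTow QBlev (L^d) (k ↦ (R_k(u)P^{(k)})^nR_k(u)) k`; PART 129's disc: `a′ > 0`, `κ > 0` admissible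
(`Jfree < gammaPs`, `deltaK < sigma0²`, `JA < gamD`), `‖u‖ ≤ T`, `Tκ₀ ≤ 1∕2` (`κ₀ = d(α+β)Cst`), `Tκ_c ≤ 1∕2` (`κ_c = d·α·G2`), `4Tκ₀Cst ≤ γ_B` where EL₂ of `c_k(u)⁻¹` is used):
* §1 (GENERIC) `opNorm_conjMat_P_mul_pertInv_le`, `opNorm_conjMat_pertChain_le`.
* §2 **`blockDecay_pertInv`** (every torus: `‖R_k(u)((w,λ),(y,ν))‖ ≤ 2e^{4κ}∕γ_w·e^{−κ·tdist(blocks)}`), `windowDecay_of_blockDecay`, **`fineWindowDecay_pertInv`** (cubic tori, fine window).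
* §3 `neumann_factor_le_two`, `towerLimitRate_mono`, **`pertChain_decay_inputs`** (`L ≥ 2`, `d ≥ 1`, every `n`: `∃ κ₁ > 0, B, B′ ≥ 0` from `(d, L, a, α, β, a′, κ, T, n)`: (UD)+(SR) of `X^{(n)}(u)` for EVERY torus, EVERY
  Lipschitz background `(α, β)`, EVERY `‖u‖ ≤ T`).
WHAT IT DOES NOT DO: EL₂ and the INPUT triple (PART 162's second file); the letters `c_k(u)⁻¹` (PART 129 ∕ 152) and the END for the derivatives at `u₀` (PART 163); mixed words at
`u₀ ≠ 0` (several backgrounds); `d ≤ 2` ∕ odd volumes.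
SUPPLIER work; NEVER «G-an2-4 closed»; NOT (CONV-C), NOT D1, NOT `BetaPertH`, NOT continuum, NOT Clay.  Records: `HOME/b2b-balaban-gan24-p3/gen56/README.md`.
-/

noncomputable section

open scoped BigOperators ComplexConjugate Matrix Matrix.Norms.L2Operator
open Filter Topology

namespace Summit.QuantumFields.BalabanUV.Beta.GAN24.PerturbedInsertionChainDecay

open Literature.MathematicalPhysics.QuantumFieldTheory.Balaban1983to89
open Literature.MathematicalPhysics.QuantumFieldTheory.Balaban1983to89.B5Prop11Plancherel (Tor fine Cst Cst_nonneg)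
open Literature.MathematicalPhysics.QuantumFieldTheory.Balaban1983to89.B5Prop11Lower (nsq)
open Literature.MathematicalPhysics.QuantumFieldTheory.Balaban1983to89.B5G183RateUnitTower (lev)
open Literature.MathematicalPhysics.QuantumFieldTheory.Balaban1983to89.B12Sec2to5 (l1)
open Literature.MathematicalPhysics.QuantumFieldTheory.Balaban1983to89.Beta (Site windowMap)
open Literature.MathematicalPhysics.QuantumFieldTheory.Balaban1983to89.Beta.FreeLegDictionary (cubic)
open Literature.MathematicalPhysics.QuantumFieldTheory.Balaban1983to89.Beta.BlockKernelVolumeSockets (evenPeriod tendsto_evenPeriod)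
open Literature.MathematicalPhysics.QuantumFieldTheory.Balaban1983to89.Beta.VectorTails (castT)
open Literature.MathematicalPhysics.QuantumFieldTheory.Balaban1983to89.Beta.VectorTailsCov (tdist tdist_self)
open Summit.QuantumFields.BalabanUV.T4Continuum
open Summit.QuantumFields.BalabanUV.T4Continuum.CovariantAveragingTower (avgTow TowerLimitRate)
open Summit.QuantumFields.BalabanUV.T4Continuum.BalabanAveragedTowerUnit (idx QBlev calGlev one_le_lev')
open Summit.QuantumFields.BalabanUV.T4Continuum.BalabanAveragedCoerciveTower (unitIdx)
open Summit.QuantumFields.BalabanUV.T4Continuum.BalabanAveragingPairing (freeTowerLaws_balaban)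
open Summit.QuantumFields.BalabanUV.T4Continuum.BackgroundResolventLaw (isUnit_det_add_smul_right)
open Summit.QuantumFields.BalabanUV.T4Continuum.KingPairingPlantedLaw (calDalev calDalev_inv isUnit_det_calDalev CJ CJ_nonneg)
open Summit.QuantumFields.BalabanUV.T4Continuum.FirstOrderBackgroundModel (LipschitzBackground Pmodel C2model perturbationLaws_firstOrder)
open Summit.QuantumFields.BalabanUV.T4Continuum.CTWeightedCoercivity (conjMat conjMat_add conjMat_smul WCoercive)
open Summit.QuantumFields.BalabanUV.T4Continuum.CTConjugationPieces (conjMat_inv)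
open Summit.QuantumFields.BalabanUV.T4Continuum.CTAveragedTowerDecay (opNorm_conjMat_pertInv_le_of_wCoercive isUnit_det_conjMat_of_wCoercive pairing_le_of_opNorm_conjMat)
open Summit.QuantumFields.BalabanUV.T4Continuum.CTKingTowerWeights (rho distK toM)
open Summit.QuantumFields.BalabanUV.T4Continuum.CTConjugatedHbd (G2 G2_nonneg wCoercive_calDa_of_conjDefect)
open Summit.QuantumFields.BalabanUV.T4Continuum.CTConjDefectDischarge (conjDefect_calDalev_rho max_JA_lt_gamD)
open Summit.QuantumFields.BalabanUV.T4Continuum.DirichletRegionTower (gamD)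
open Summit.QuantumFields.BalabanUV.T4Continuum.ScalarAveragedPropagator (gammaPs)
open Summit.QuantumFields.BalabanUV.T4Continuum.ScalarAveragedCompression (sigma0)
open Summit.QuantumFields.BalabanUV.T4Continuum.CTScalarGreen (Jfree)
open Summit.QuantumFields.BalabanUV.T4Continuum.CTGaugeTerm (deltaK)
open Summit.QuantumFields.BalabanUV.T4Continuum.CTVectorPropagator (JA)
open Summit.QuantumFields.BalabanUV.T4Continuum.DecayRateInterpolation (EntryDecay DecayRate TwoLevelDecayRate decayRate_of_towerLimitRate)
open Summit.QuantumFields.BalabanUV.Beta.GAN24.DiagramDecayAlgebra (entryDecay_add)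
open Summit.QuantumFields.BalabanUV.Beta.GAN24.UnitLatticeDecayAlgebra (distK_nonneg toM_bijective)
open Summit.QuantumFields.BalabanUV.Beta.GAN24.EffectiveFormDecay (entryDecay_of_le_rate)
open Summit.QuantumFields.BalabanUV.Beta.GAN24.InsertionChainDecay (hPc_firstOrder opNorm_conjMat_insertion_le)
open Summit.QuantumFields.BalabanUV.Beta.GAN24.InsertionChainDecayBalaban (hdecB_of_conjBound conjMat_sub_const rho_le_one_of_near distK_sub_three_le_rho_of_near)
open Summit.QuantumFields.BalabanUV.Beta.GAN24.InsertionChainLawCoupling (opNorm_P_mul_perturbed_le towerLimitRate_insertion_at_coupling)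
open Summit.QuantumFields.BalabanUV.Beta.GAN24.DiagramVolumeLimitPairs (l1_windowMap_neg)
open Summit.QuantumFields.BalabanUV.Beta.GAN24.VolumeLimitPairsFibre (tendsto_mul_pair')
open Summit.QuantumFields.BalabanUV.Beta.GAN24.FinePropagatorDecay (single_pairing nsq_single wCoercive_sub_const l1_windowMap_le_block)
open Summit.QuantumFields.BalabanUV.Beta.GAN24.FineInsertionVolumeLimit (norm_mul_apply_le_of_window)
open Summit.QuantumFields.BalabanUV.Beta.GAN24.PerturbedPropagatorVolumeLimit (tendsto_Pmodel_mul_pair norm_Pmodel_mul_apply_le tendsto_avgTow_pair_of_fine tendsto_pertInv_pair)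
open Summit.QuantumFields.BalabanUV.Beta.GAN24.InsertionWordVolumeLimit (tendsto_one_pair)

variable {d : ℕ} (L : ℕ) [NeZero L] (a : ℝ) (ha : 0 < a)

/-! ## §1 Generic: the conjugated letters at coupling `u` -/

section Conj

variable {ι : Type*} [Fintype ι] [DecidableEq ι]

/-- **the conjugated (H-bd) at coupling `t`**: `WCoercive D κ ρ γ_w`, `‖c(P)c(D⁻¹)‖ ≤ κ′`, `‖t‖κ′ < 1` ⟹ `‖c(P)·c((D + tP)⁻¹)‖ ≤ κ′(1 − ‖t‖κ′)⁻¹` (PART 120's `opNorm_P_mul_perturbed_le` on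
the conjugated pair; `c` is multiplicative and commutes with inversion). [folklore] -/
theorem opNorm_conjMat_P_mul_pertInv_le {D P : Matrix ι ι ℂ} {κ : ℝ} {ρ : ι → ℝ} {γw κ' : ℝ} (hW : WCoercive D κ ρ γw) (hγ : 0 < γw)
    (hP : ‖conjMat κ ρ ρ P * conjMat κ ρ ρ D⁻¹‖ ≤ κ') {t : ℂ} (ht : ‖t‖ * κ' < 1) :
    ‖conjMat κ ρ ρ P * conjMat κ ρ ρ (D + t • P)⁻¹‖ ≤ κ' * (1 - ‖t‖ * κ')⁻¹ := by
  have hD := isUnit_det_conjMat_of_wCoercive hW hγ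
  rw [conjMat_inv] at hP
  have h := opNorm_P_mul_perturbed_le hD hP ht
  rwa [← conjMat_smul, ← conjMat_add, ← conjMat_inv] at h

/-- **the conjugated chain at coupling `t`**: `‖c(((D + tP)⁻¹P)^n(D + tP)⁻¹)‖ ≤ γ_w⁻¹ν·(κ′ν)^n`, `ν = (1 − ‖t‖κ′)⁻¹` (PART 124's `opNorm_conjMat_insertion_le` with the two letters at `t`).
[folklore] -/
theorem opNorm_conjMat_pertChain_le {D P : Matrix ι ι ℂ} {κ : ℝ} {ρ : ι → ℝ} {γw κ' : ℝ} (hW : WCoercive D κ ρ γw) (hγ : 0 < γw)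
    (hP : ‖conjMat κ ρ ρ P * conjMat κ ρ ρ D⁻¹‖ ≤ κ') {t : ℂ} (ht : ‖t‖ * κ' < 1) (n : ℕ) :
    ‖conjMat κ ρ ρ (((D + t • P)⁻¹ * P) ^ n * (D + t • P)⁻¹)‖ ≤ γw⁻¹ * (1 - ‖t‖ * κ')⁻¹ * (κ' * (1 - ‖t‖ * κ')⁻¹) ^ n :=
  opNorm_conjMat_insertion_le (opNorm_conjMat_pertInv_le_of_wCoercive hW hγ hP ht) (opNorm_conjMat_P_mul_pertInv_le hW hγ hP ht) n

end Conj

/-! ## §2 The fine propagator at coupling `u` decays, volume-free -/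

section FineDecay

/-- **`blockDecay_pertInv` — THE PERTURBED FINE PROPAGATOR's BLOCK DECAY, VOLUME-FREE** [our proof] (every torus `M`, level `k`, Lipschitz background `(α, β)`, admissible `(a′, κ)`,
`‖u‖ ≤ T`, `T·κ_c ≤ 1∕2`): `‖(Δ_a^{(k)} + uP^{(k)})⁻¹((w,λ),(y,ν))‖ ≤ 2e^{4κ}∕(γ_D − J)·e^{−κ·tdist(blockOf w, blockOf y)}` — NE2's weighted coercivity of `Δ_a` at King's weight
centred at the block of `y` (shifted by `1`), the conjugated Neumann bound at coupling `u`, read entrywise through `pairing_le_of_opNorm_conjMat` with indicator vectors (PART 145 is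
`u = 0`). [cite: Balaban1984PropagatorsI, Prop. 1.1 (1.89) p.33 (decay of `G`: the object)] -/
theorem blockDecay_pertInv {α β a' κ T : ℝ} (ha' : 0 < a') (hκ0 : 0 < κ)
    (hγ' : Jfree d a' κ 1 < gammaPs d a') (hδ' : deltaK d a' κ 1 < sigma0 d a' ^ 2) (hJA : JA d a a' κ 1 < gamD d a)
    (hT₂ : T * (d * (α * G2 d a (max (JA d a a' κ 1) 0) (gamD d a - max (JA d a a' κ 1) 0) κ)) ≤ 1 / 2)
    (M : Fin d → ℕ) [∀ μ, NeZero (M μ)] {V : (k : ℕ) → Fin d → (idx L M k → ℂ)} (hV : LipschitzBackground L M V α β)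
    {u : ℂ} (hu : ‖u‖ ≤ T) (k : ℕ) (w y : Tor (fine (lev L k) M)) (l ν : Fin d) :
    ‖(calDalev L M a ha k + u • Pmodel L M V k)⁻¹ (w, l) (y, ν)‖
      ≤ 2 * Real.exp (κ * 4) / (gamD d a - max (JA d a a' κ 1) 0)
        * Real.exp (-(κ * (tdist (B5Blocks16.blockOf (lev L k) M w) (B5Blocks16.blockOf (lev L k) M y) : ℝ))) := by
  set J : ℝ := max (JA d a a' κ 1) 0 with hJdef
  have hJ0 : 0 ≤ J := le_max_right _ _
  have hJγ : J < gamD d a := max_JA_lt_gamD a hJA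
  set κc : ℝ := d * (α * G2 d a J (gamD d a - J) κ) with hκc
  have hα : 0 ≤ α := hV.nonneg.1
  have hκc0 : 0 ≤ κc := by have := G2_nonneg (d := d) a J (sub_pos.mpr hJγ) κ; positivity
  have htc : ‖u‖ * κc < 1 := by nlinarith [mul_le_mul_of_nonneg_right hu hκc0, norm_nonneg u]
  have hνc : (1 - ‖u‖ * κc)⁻¹ ≤ 2 := by
    have h1 : (1 : ℝ) / 2 ≤ 1 - ‖u‖ * κc := by nlinarith [mul_le_mul_of_nonneg_right hu hκc0, norm_nonneg u]
    have := inv_anti₀ (by norm_num : (0 : ℝ) < 1 / 2) h1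
    rwa [one_div, inv_inv] at this
  -- unit sites labelling the two blocks; the weight centred at the block of `y`, shifted by `1`
  obtain ⟨x₀, hx₀⟩ := (toM_bijective L M).2 (B5Blocks16.blockOf (lev L k) M w)
  obtain ⟨y₀, hy₀⟩ := (toM_bijective L M).2 (B5Blocks16.blockOf (lev L k) M y)
  have hW : WCoercive (calDalev L M a ha k) κ (rho L M k (y₀, ν)) (gamD d a - J) :=
    wCoercive_calDa_of_conjDefect (lev L k) (one_le_lev' L k) M a ha (conjDefect_calDalev_rho L M a ha ha' hγ' hδ' k (y₀, ν))
  have hW' := wCoercive_sub_const hW 1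
  have hPc : ‖conjMat κ (fun e => rho L M k (y₀, ν) e - 1) (fun e => rho L M k (y₀, ν) e - 1) (Pmodel L M V k)
      * conjMat κ (fun e => rho L M k (y₀, ν) e - 1) (fun e => rho L M k (y₀, ν) e - 1) (calDalev L M a ha k)⁻¹‖ ≤ κc := by
    rw [conjMat_sub_const, conjMat_sub_const]
    exact hPc_firstOrder L M a ha hV hJ0 hJγ k (y₀, ν) (conjDefect_calDalev_rho L M a ha ha' hγ' hδ' k (y₀, ν))
  have hK := opNorm_conjMat_pertInv_le_of_wCoercive hW' (sub_pos.mpr hJγ) hPc htc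
  have hK' : ‖conjMat κ (fun e => rho L M k (y₀, ν) e - 1) (fun e => rho L M k (y₀, ν) e - 1) (calDalev L M a ha k + u • Pmodel L M V k)⁻¹‖ ≤ (gamD d a - J)⁻¹ * 2 :=
    hK.trans (mul_le_mul_of_nonneg_left hνc (inv_nonneg.mpr (sub_pos.mpr hJγ).le))
  have hnear_w : tdist (toM L M (x₀, l).1) (B5Blocks16.blockOf (lev L k) M (w, l).1) ≤ 1 := by
    simp only [hx₀, tdist_self]; exact zero_le_one
  have hnear_y : tdist (toM L M (y₀, ν).1) (B5Blocks16.blockOf (lev L k) M (y, ν).1) ≤ 1 := by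
    simp only [hy₀, tdist_self]; exact zero_le_one
  have hu' : ∀ e : idx L M k, (Pi.single (w, l) (1 : ℂ) : idx L M k → ℂ) e ≠ 0 → distK L M (x₀, l) (y₀, ν) - 4 ≤ rho L M k (y₀, ν) e - 1 := by
    intro e he
    have : e = (w, l) := by by_contra hne; exact he (Pi.single_eq_of_ne hne _)
    subst this
    have := distK_sub_three_le_rho_of_near L M k (x₀, l) (y₀, ν) (w, l) hnear_w
    linarith
  have hv' : ∀ e : idx L M k, (Pi.single (y, ν) (1 : ℂ) : idx L M k → ℂ) e ≠ 0 → rho L M k (y₀, ν) e - 1 ≤ 0 := by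
    intro e he
    have : e = (y, ν) := by by_contra hne; exact he (Pi.single_eq_of_ne hne _)
    subst this
    have := rho_le_one_of_near L M k (y₀, ν) (y, ν) hnear_y
    linarith
  have h := pairing_le_of_opNorm_conjMat hκ0.le hK' hu' hv'
  rw [single_pairing, nsq_single, nsq_single, Real.sqrt_one, mul_one, mul_one] at h
  refine h.trans (le_of_eq ?_)
  have hdist : distK L M (x₀, l) (y₀, ν) = (tdist (B5Blocks16.blockOf (lev L k) M w) (B5Blocks16.blockOf (lev L k) M y) : ℝ) := by
    unfold distK; rw [hx₀, hy₀]
  rw [hdist, show -(κ * ((tdist (B5Blocks16.blockOf (lev L k) M w) (B5Blocks16.blockOf (lev L k) M y) : ℝ) - 4))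
      = κ * 4 + -(κ * (tdist (B5Blocks16.blockOf (lev L k) M w) (B5Blocks16.blockOf (lev L k) M y) : ℝ)) by ring, Real.exp_add]
  ring

omit [NeZero L] in
/-- block decay ⟹ fine window decay on cubic tori: `A·e^{−κ·tdist(blocks)} ≤ A·e^{κ}·e^{−(κ∕(d n))|windowMap_{n s}(w − y)|₁}` (PART 145's `l1_windowMap_le_block`). [folklore] -/
theorem windowDecay_of_blockDecay {κ A : ℝ} (hκ : 0 < κ) (hA : 0 ≤ A) (n s : ℕ) [NeZero n] [NeZero s] (w y : Tor (fine n (cubic d s))) :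
    A * Real.exp (-(κ * (tdist (B5Blocks16.blockOf n (cubic d s) w) (B5Blocks16.blockOf n (cubic d s) y) : ℝ)))
      ≤ A * Real.exp κ * Real.exp (-(κ / (d * n)) * l1 (windowMap d (n * s) (w - y))) := by
  rw [mul_assoc]
  refine mul_le_mul_of_nonneg_left ?_ hA
  rw [← Real.exp_add]
  refine Real.exp_le_exp.mpr ?_
  have hn : (0 : ℝ) < n := by exact_mod_cast Nat.pos_of_ne_zero (NeZero.ne n)
  have key : κ / (d * n) * l1 (windowMap d (n * s) (w - y)) ≤ κ * ((tdist (B5Blocks16.blockOf n (cubic d s) w) (B5Blocks16.blockOf n (cubic d s) y) : ℝ) + 1) := by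
    rcases Nat.eq_zero_or_pos d with hd | hd
    · have hl0 : l1 (windowMap d (n * s) (w - y)) = 0 := by subst hd; simp [l1]
      rw [hl0, mul_zero]; positivity
    have hd0 : (0 : ℝ) < d := by exact_mod_cast hd
    have hl := l1_windowMap_le_block (d := d) n s w y
    rw [div_mul_eq_mul_div, div_le_iff₀ (mul_pos hd0 hn)]
    calc κ * l1 (windowMap d (n * s) (w - y))
        ≤ κ * (d * n * ((tdist (B5Blocks16.blockOf n (cubic d s) w) (B5Blocks16.blockOf n (cubic d s) y) : ℝ) + 1)) := mul_le_mul_of_nonneg_left hl hκ.le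
      _ = κ * ((tdist (B5Blocks16.blockOf n (cubic d s) w) (B5Blocks16.blockOf n (cubic d s) y) : ℝ) + 1) * (d * n) := by ring
  linarith

/-- **`fineWindowDecay_pertInv` — THE PERTURBED FINE PROPAGATOR's WINDOW DECAY AT PAIRS ON CUBIC TORI, VOLUME-FREE** [our proof]: on every cubic torus `(ℤ∕s)^d`, level `k`
(`n_k = L^k`), Lipschitz background `(α, β)` and coupling `‖u‖ ≤ T` of the disc, `‖(Δ_a^{(k)} + uP^{(k)})⁻¹((w,λ),(y,ν))‖ ≤ (2e^{4κ}∕(γ_D − J))·e^{κ}·e^{−(κ∕(d n_k))|windowMap(w − y)|₁}` —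
input (b) of PART 144 ∕ the left-decay letter of PART 159 §1 at coupling `u`. -/
theorem fineWindowDecay_pertInv {α β a' κ T : ℝ} (ha' : 0 < a') (hκ0 : 0 < κ)
    (hγ' : Jfree d a' κ 1 < gammaPs d a') (hδ' : deltaK d a' κ 1 < sigma0 d a' ^ 2) (hJA : JA d a a' κ 1 < gamD d a)
    (hT₂ : T * (d * (α * G2 d a (max (JA d a a' κ 1) 0) (gamD d a - max (JA d a a' κ 1) 0) κ)) ≤ 1 / 2)
    (s : ℕ) [NeZero s] {V : (k : ℕ) → Fin d → (idx L (cubic d s) k → ℂ)} (hV : LipschitzBackground L (cubic d s) V α β)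
    {u : ℂ} (hu : ‖u‖ ≤ T) (k : ℕ) (w y : Tor (fine (lev L k) (cubic d s))) (l ν : Fin d) :
    ‖(calDalev L (cubic d s) a ha k + u • Pmodel L (cubic d s) V k)⁻¹ (w, l) (y, ν)‖
      ≤ 2 * Real.exp (κ * 4) / (gamD d a - max (JA d a a' κ 1) 0) * Real.exp κ * Real.exp (-(κ / (d * lev L k)) * l1 (windowMap d (lev L k * s) (w - y))) := by
  have hJγ : max (JA d a a' κ 1) 0 < gamD d a := max_JA_lt_gamD a hJA
  have hA : 0 ≤ 2 * Real.exp (κ * 4) / (gamD d a - max (JA d a a' κ 1) 0) := by have := sub_pos.mpr hJγ; positivity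
  exact (blockDecay_pertInv L a ha ha' hκ0 hγ' hδ' hJA hT₂ (cubic d s) hV hu k w y l ν).trans (windowDecay_of_blockDecay hκ0 hA (lev L k) s w y)

end FineDecay

/-! ## §3 (UD)+(SR) of the insertion chains at coupling `u`, volume-free and `u`-uniform on the disc -/

section Decay

omit [NeZero L] in
/-- the Neumann factor on the half disc: `x ≤ 1∕2` ⟹ `x < 1`, `0 ≤ (1 − x)⁻¹ ≤ 2`. [folklore] -/
theorem neumann_factor_le_two {x : ℝ} (hx : x ≤ 1 / 2) : x < 1 ∧ 0 ≤ (1 - x)⁻¹ ∧ (1 - x)⁻¹ ≤ 2 := by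
  refine ⟨by linarith, inv_nonneg.mpr (by linarith), ?_⟩
  have h1 : (1 : ℝ) / 2 ≤ 1 - x := by linarith
  have := inv_anti₀ (by norm_num : (0 : ℝ) < 1 / 2) h1
  rwa [one_div, inv_inv] at this

omit [NeZero L] in
/-- `TowerLimitRate` is monotone in its constant. [folklore] -/
theorem towerLimitRate_mono {ι : ℕ → Type*} [∀ k, Fintype (ι k)] [∀ k, DecidableEq (ι k)] {A : (k : ℕ) → Matrix (ι k) (ι (k + 1)) ℂ} {r : ℝ}
    {X : (k : ℕ) → Matrix (ι k) (ι k) ℂ} {C C' ρ : ℝ} (h : TowerLimitRate A r X C ρ) (hC : C ≤ C') (hρ0 : 0 ≤ ρ) (hρ1 : ρ < 1) : TowerLimitRate A r X C' ρ := by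
  obtain ⟨Xlim, hlim, hrate⟩ := h
  refine ⟨Xlim, hlim, fun k => (hrate k).trans ?_⟩
  exact div_le_div_of_nonneg_right (mul_le_mul_of_nonneg_right hC (pow_nonneg hρ0 k)) (sub_pos.mpr hρ1).le

/-- **`pertChain_decay_inputs` — (UD)+(SR) OF `X^{(n)}_k(u) = L^{dk}Q_k((R_k(u)P)^nR_k(u))Q_kᴴ`, VOLUME-FREE AND `u`-UNIFORM ON THE DISC** (`L ≥ 2`, `d ≥ 1`, `α, β ≥ 0`, admissible
`(a′, κ)`, `T ≥ 0` with `Tκ₀ ≤ 1∕2`, `Tκ_c ≤ 1∕2`, every `n`): `∃ κ₁ > 0, B, B′ ≥ 0` such that for EVERY torus `M`, EVERY background with `LipschitzBackground L M V α β` and EVERY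
`‖u‖ ≤ T`: (UD) `EntryDecay distK (X^{(n)}_k(u)) B κ₁` ∀ `k`, (SR) `TwoLevelDecayRate distK X^{(n)}(u) B′ κ₁ (√(L⁻¹))` — PART 120's `towerLimitRate_insertion_at_coupling` on Bałaban's
tower (Neumann factors `≤ 2`, `‖u‖ ≤ T`), §1's conjugated chain bound, PART 126's dictionary, `decayRate_of_towerLimitRate` (PART 156 §2 is `u = 0`). -/
theorem pertChain_decay_inputs (hL : 2 ≤ L) (hd : 1 ≤ d) {α β a' κ T : ℝ} (hα : 0 ≤ α) (hβ : 0 ≤ β) (ha' : 0 < a') (hκ0 : 0 < κ)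
    (hγ' : Jfree d a' κ 1 < gammaPs d a') (hδ' : deltaK d a' κ 1 < sigma0 d a' ^ 2) (hJA : JA d a a' κ 1 < gamD d a) (hT0 : 0 ≤ T)
    (hT₁ : T * (d * (α + β) * Cst d a) ≤ 1 / 2)
    (hT₂ : T * (d * (α * G2 d a (max (JA d a a' κ 1) 0) (gamD d a - max (JA d a a' κ 1) 0) κ)) ≤ 1 / 2) (n : ℕ) :
    ∃ κ₁ B B' : ℝ, 0 < κ₁ ∧ 0 ≤ B ∧ 0 ≤ B' ∧ ∀ (M : Fin d → ℕ) [∀ μ, NeZero (M μ)] (V : (k : ℕ) → Fin d → (idx L M k → ℂ)),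
      LipschitzBackground L M V α β → ∀ (u : ℂ), ‖u‖ ≤ T →
      (∀ k, EntryDecay (distK L M) (avgTow (QBlev L M) ((L : ℝ) ^ d)
        (fun k => ((calDalev L M a ha k + u • Pmodel L M V k)⁻¹ * Pmodel L M V k) ^ n * (calDalev L M a ha k + u • Pmodel L M V k)⁻¹) k) B κ₁) ∧
      TwoLevelDecayRate (distK L M) (avgTow (QBlev L M) ((L : ℝ) ^ d)
        (fun k => ((calDalev L M a ha k + u • Pmodel L M V k)⁻¹ * Pmodel L M V k) ^ n * (calDalev L M a ha k + u • Pmodel L M V k)⁻¹)) B' κ₁ (Real.sqrt ((L : ℝ)⁻¹)) := by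
  set J : ℝ := max (JA d a a' κ 1) 0 with hJdef
  have hJ0 : 0 ≤ J := le_max_right _ _
  have hJγ : J < gamD d a := max_JA_lt_gamD a hJA
  set κc : ℝ := d * (α * G2 d a J (gamD d a - J) κ) with hκc
  set κ₀ : ℝ := d * (α + β) * Cst d a with hκ₀
  have hCst := Cst_nonneg d a
  have hCJ := CJ_nonneg d a
  have hκ₀0 : 0 ≤ κ₀ := by positivity
  have hκc0 : 0 ≤ κc := by have := G2_nonneg (d := d) a J (sub_pos.mpr hJγ) κ; positivity
  have hC2 : 0 ≤ C2model d L a α β := by unfold C2model; positivity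
  -- the `u`-uniform constants (Neumann factors replaced by `2`, `‖u‖` by `T`)
  set CT : ℝ := ((n + 1) * (κ₀ * 2) ^ n * ((CJ d a + T * C2model d L a α β) * (2 : ℝ) ^ 2) + n * (κ₀ * 2) ^ (n - 1) * ((2 : ℝ) ^ 2 * C2model d L a α β))
    + (κ₀ * 2) ^ n * (2 * (2 * d * Cst d a) + 2 * (d * L * Cst d a * 2)) with hCT
  have hCT0 : 0 ≤ CT := by positivity
  set Bl : ℝ := (gamD d a - J)⁻¹ * 2 * (κc * 2) ^ n * Real.exp (κ * 4) with hBl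
  have hBl0 : 0 ≤ Bl := by have := sub_pos.mpr hJγ; positivity
  set R : ℝ := Real.sqrt (2 * Bl * (CT / (1 - (L : ℝ)⁻¹))) with hR
  set R' : ℝ := Real.sqrt (2 * Bl * (2 * CT / (1 - (L : ℝ)⁻¹))) with hR'
  have hL1 : (1 : ℝ) < L := by exact_mod_cast (lt_of_lt_of_le one_lt_two hL : 1 < L)
  have hρ0 : (0 : ℝ) ≤ (L : ℝ)⁻¹ := inv_nonneg.mpr (Nat.cast_nonneg _)
  have hρ1 : ((L : ℝ)⁻¹) < 1 := inv_lt_one_of_one_lt₀ hL1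
  have hr : (0 : ℝ) < (L : ℝ) ^ d := pow_pos (lt_trans zero_lt_one hL1) d
  have hθ0 : 0 ≤ Real.sqrt ((L : ℝ)⁻¹) := Real.sqrt_nonneg _
  have hθ1 : Real.sqrt ((L : ℝ)⁻¹) ≤ 1 := by rw [Real.sqrt_le_one]; exact inv_le_one_of_one_le₀ hL1.le
  refine ⟨κ / 2, Bl + R, R', half_pos hκ0, add_nonneg hBl0 (Real.sqrt_nonneg _), Real.sqrt_nonneg _, fun M _ V hV u hu => ?_⟩
  -- Neumann factors on the disc
  obtain ⟨ht₀, hν0, hν⟩ := neumann_factor_le_two ((mul_le_mul_of_nonneg_right hu hκ₀0).trans hT₁)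
  obtain ⟨htc, hνc0, hνc⟩ := neumann_factor_le_two ((mul_le_mul_of_nonneg_right hu hκc0).trans hT₂)
  -- the rate half (PART 120 on Bałaban's tower), constant raised to `CT`
  have hT' := towerLimitRate_insertion_at_coupling hr (freeTowerLaws_balaban L M a ha) (perturbationLaws_firstOrder L M a ha hd hV) hρ1
    (fun k => le_rfl) (fun k => le_rfl) (fun k => le_rfl) (fun k => le_rfl) ht₀ n
  set ν : ℝ := (1 - ‖u‖ * κ₀)⁻¹ with hνdef
  have hx0 : 0 ≤ κ₀ * ν := mul_nonneg hκ₀0 hν0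
  have hx : κ₀ * ν ≤ κ₀ * 2 := mul_le_mul_of_nonneg_left hν hκ₀0
  have hxn : (κ₀ * ν) ^ n ≤ (κ₀ * 2) ^ n := pow_le_pow_left₀ hx0 hx n
  have hxn1 : (κ₀ * ν) ^ (n - 1) ≤ (κ₀ * 2) ^ (n - 1) := pow_le_pow_left₀ hx0 hx (n - 1)
  have hν2 : ν ^ 2 ≤ (2 : ℝ) ^ 2 := pow_le_pow_left₀ hν0 hν 2
  have hA : CJ d a + ‖u‖ * C2model d L a α β ≤ CJ d a + T * C2model d L a α β := by
    have := mul_le_mul_of_nonneg_right hu hC2; linarith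
  have hle : ((n + 1) * (κ₀ * ν) ^ n * ((CJ d a + ‖u‖ * C2model d L a α β) * ν ^ 2)
        + n * (κ₀ * ν) ^ (n - 1) * (ν ^ 2 * C2model d L a α β))
      + (κ₀ * ν) ^ n * (ν * (2 * d * Cst d a) + 2 * (d * L * Cst d a * ν)) ≤ CT := by
    rw [hCT]
    refine add_le_add (add_le_add ?_ ?_) ?_
    · exact mul_le_mul (mul_le_mul_of_nonneg_left hxn (by positivity)) (mul_le_mul hA hν2 (by positivity) (by positivity)) (by positivity) (by positivity)
    · exact mul_le_mul (mul_le_mul_of_nonneg_left hxn1 (by positivity)) (mul_le_mul_of_nonneg_right hν2 hC2) (by positivity) (by positivity)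
    · exact mul_le_mul hxn (add_le_add (mul_le_mul_of_nonneg_right hν (by positivity)) (mul_le_mul_of_nonneg_left (mul_le_mul_of_nonneg_left hν (by positivity)) (by norm_num)))
        (by positivity) (by positivity)
  have hT := towerLimitRate_mono hT' hle hρ0 hρ1
  -- the decay half (PART 126's dictionary on §1's conjugated chain bound)
  have hW : ∀ (k : ℕ) (y : idx L M 0), WCoercive (calDalev L M a ha k) κ (rho L M k y) (gamD d a - J) :=
    fun k y => wCoercive_calDa_of_conjDefect (lev L k) (one_le_lev' L k) M a ha (conjDefect_calDalev_rho L M a ha ha' hγ' hδ' k y)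
  have hPc : ∀ (k : ℕ) (y : idx L M 0),
      ‖conjMat κ (rho L M k y) (rho L M k y) (Pmodel L M V k) * conjMat κ (rho L M k y) (rho L M k y) (calDalev L M a ha k)⁻¹‖ ≤ κc :=
    fun k y => hPc_firstOrder L M a ha hV hJ0 hJγ k y (conjDefect_calDalev_rho L M a ha ha' hγ' hδ' k y)
  have hdec : ∀ k, EntryDecay (distK L M) (avgTow (QBlev L M) ((L : ℝ) ^ d)
      (fun k => ((calDalev L M a ha k + u • Pmodel L M V k)⁻¹ * Pmodel L M V k) ^ n * (calDalev L M a ha k + u • Pmodel L M V k)⁻¹) k) Bl κ := by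
    intro k
    have h := hdecB_of_conjBound L M (X := fun k => ((calDalev L M a ha k + u • Pmodel L M V k)⁻¹ * Pmodel L M V k) ^ n * (calDalev L M a ha k + u • Pmodel L M V k)⁻¹)
      hκ0.le (fun k y => opNorm_conjMat_pertChain_le (hW k y) (sub_pos.mpr hJγ) (hPc k y) htc n) k
    refine h.mono ?_
    rw [hBl]
    have h1 : 0 ≤ (gamD d a - J)⁻¹ := inv_nonneg.mpr (sub_pos.mpr hJγ).le
    have h2 : (κc * (1 - ‖u‖ * κc)⁻¹) ^ n ≤ (κc * 2) ^ n := pow_le_pow_left₀ (by positivity) (mul_le_mul_of_nonneg_left hνc hκc0) n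
    have h3 : (gamD d a - J)⁻¹ * (1 - ‖u‖ * κc)⁻¹ ≤ (gamD d a - J)⁻¹ * 2 := mul_le_mul_of_nonneg_left hνc h1
    exact mul_le_mul_of_nonneg_right (mul_le_mul h3 h2 (by positivity) (by positivity)) (Real.exp_pos _).le
  obtain ⟨clim, -, hlim, hrate, hstep⟩ := decayRate_of_towerLimitRate hρ0 hρ1 hCT0 hT hdec
  refine ⟨fun k => ?_, fun k x y => (hstep k x y).trans (le_of_eq (by rw [hR']))⟩
  have h1 : EntryDecay (distK L M) clim Bl (κ / 2) := entryDecay_of_le_rate (distK_nonneg L M) hlim hBl0 (half_le_self hκ0.le)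
  have h2 : EntryDecay (distK L M) (avgTow (QBlev L M) ((L : ℝ) ^ d)
      (fun k => ((calDalev L M a ha k + u • Pmodel L M V k)⁻¹ * Pmodel L M V k) ^ n * (calDalev L M a ha k + u • Pmodel L M V k)⁻¹) k - clim) R (κ / 2) := by
    intro x y
    refine (hrate k x y).trans ?_
    rw [hR]
    exact mul_le_mul_of_nonneg_right (mul_le_of_le_one_right (Real.sqrt_nonneg _) (pow_le_one₀ hθ0 hθ1)) (Real.exp_pos _).le
  have e2 : avgTow (QBlev L M) ((L : ℝ) ^ d)
      (fun k => ((calDalev L M a ha k + u • Pmodel L M V k)⁻¹ * Pmodel L M V k) ^ n * (calDalev L M a ha k + u • Pmodel L M V k)⁻¹) k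
      = clim + (avgTow (QBlev L M) ((L : ℝ) ^ d)
      (fun k => ((calDalev L M a ha k + u • Pmodel L M V k)⁻¹ * Pmodel L M V k) ^ n * (calDalev L M a ha k + u • Pmodel L M V k)⁻¹) k - clim) := by abel
  rw [e2]
  exact entryDecay_add h1 h2

end Decay

end Summit.QuantumFields.BalabanUV.Beta.GAN24.PerturbedInsertionChainDecay

end
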